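import Summits.CriticalPhenomena.PercolationContinuityZ3.Theorems.PercNearOneGluingNoHeavyQuantSliceSmallLayers
import Summits.CriticalPhenomena.PercolationContinuityZ3.Theorems.PercNearOneGluingNoHeavyQuantFlowPieces
import Summits.CriticalPhenomena.PercolationContinuityZ3.Theorems.PercNearOneGluingNoHeavyQuantLawDecFlowsDecomposition
import HarnessLib

/-!
# QUANT lane R8, T-DEC, leg (III): the GATED TWO-POINT CELLS of the blob gate move — law facts, and the ZERO-ONLY cells are DEC
# (`gateCell_decAtT_of_noLow`, `gateCell_decAtT_of_le`: no nonzero `t`-low ⟹ DEC at the mean by `flowAtT_of_moment`)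

builds on p205010 (kernel theorem, internal audit signed; external expert review pending)

Support file (`--supports stmt-CriticalPhenomena-4575`), QUANT lane lead seat prim-quant-lead (gen 30), rung R8 of
`run/shared/lean/prim/quant/LADDER.md`.  Theorems only, standard axioms, no sorries.  Companion of `…QuantGateMoveBlobCells` (lead g30:
`decAtT_gateMoveBlob_of_cells` — the move lemma (M) for an arbitrary law follows from the cells below); memo
`run/shared/lean/prim/quant/FOR-PROVERS-R2.md` §2–§3b (README V315).

THE CELL.  For `lo ≤ hi ≤ M`, `0 ≤ γ ≤ 1`, `0 ≤ z < 1`, blob `{0, a; g}`:  `Q h := z·[h = 0] + (1 − z)·slice TP[lo, hi; γ] a g h`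
(atoms `0`, `lo`, `hi`, `lo + a`, `hi + a`), of mass `1` and mean `t = (1 − z)(lo + (hi − lo)γ + ag)` (`gateCell_laws`).  In the regime
`t ≤ 2a` every atom `≥ a` is a `t`-absorber, so the only possible nonzero `t`-lows are `lo` and `hi` themselves; when neither is one
(`t ≤ 2·lo`, or `lo = 0` and `t ≤ 2·hi`, … : ≈ 82 % of the cells of the census, FOR-PROVERS-R2 §3b) the zero is the only low and the cell is
DEC at `(y, t, j)` for EVERY `j` by the moment criterion (`flowAtT_of_moment`: top-affordability `y·(M + a) ≤ t` and mean `= t`).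
The cells with a nonzero low (`lo` or `hi` below `t/2`) are the next seat's (own twin `ℓ ↦ ℓ + a`, spill to `hi + a`; §3b).

* `LawDec.sum_mul_TP_range` — the mean of a two-point law.
* `LawDec.gateCell_laws` — `Q ≥ 0`, `Q = 0` above `M + a`, mass `1`, mean `(1 − z)(lo + (hi − lo)γ) + (1 − z)ag`.
* **`LawDec.gateCell_decAtT_of_noLow`** — no nonzero `t`-low ⟹ `DECAtT y t j (M + a) Q` (`y·M ≤ (1−z)(lo + (hi−lo)γ)`, `y ≤ (1−z)g`).
* **`LawDec.gateCell_decAtT_of_le`** — the same from `t ≤ 2a` and `t ≤ 2k` for every nonzero `k ∈ {lo, hi}` charged by `TP[lo, hi; γ]`.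

HONEST STATUS: the cells with a nonzero low, (M)/`TwinMoveDEC` and everything above remain OPEN; RATE class log\* / honest sentence unchanged.

[this work]; (M): prim-quant-stmt g27; cells plan: lead g30 (this lane).  Nothing here is cited as a published result.  The gluing rows served
[cite: KozmaNitzan2024, Conjecture 3 (p. 15)]; product measure [cite: Grimmett1999, §1.3 p. 10].
-/

noncomputable section

namespace Summit.CriticalPhenomena.PercolationContinuityZ3.Theorems

namespace Quant

open Finset

/-- the two-point law `{lo, hi; g}` (as in `…QuantLawDEC`) -/
local notation3 "TP[" lo ", " hi ", " g ", " h "]" =>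
  (g : ℝ) * (if (h : ℕ) = (hi : ℕ) then (1 : ℝ) else 0) + (1 - (g : ℝ)) * (if (h : ℕ) = (lo : ℕ) then (1 : ℝ) else 0)

namespace LawDec

/-- the mean of a two-point law on `{0..M}`: `Σ h·TP[lo, hi; γ](h) = lo + (hi − lo)γ`. [this work] -/
theorem sum_mul_TP_range (M lo hi : ℕ) (γ : ℝ) (hlo : lo ≤ M) (hhi : hi ≤ M) :
    ∑ h ∈ Finset.range (M + 1), (h : ℝ) * TP[lo, hi, γ, h] = (lo : ℝ) + ((hi : ℝ) - lo) * γ := by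
  have e : ∀ h : ℕ, (h : ℝ) * TP[lo, hi, γ, h]
      = γ * (if h = hi then (hi : ℝ) else 0) + (1 - γ) * (if h = lo then (lo : ℝ) else 0) := by
    intro h
    by_cases h1 : h = hi
    · by_cases h2 : h = lo
      · subst h1; rw [if_pos rfl, if_pos h2, if_pos rfl, if_pos h2, h2]; ring
      · subst h1; rw [if_pos rfl, if_neg h2, if_pos rfl, if_neg h2]; ring
    · by_cases h2 : h = lo
      · subst h2; rw [if_neg h1, if_pos rfl, if_neg h1, if_pos rfl]; ring
      · rw [if_neg h1, if_neg h2, if_neg h1, if_neg h2]; ring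
  simp_rw [e]
  rw [Finset.sum_add_distrib, ← Finset.mul_sum, ← Finset.mul_sum, Finset.sum_ite_eq' (Finset.range (M + 1)) hi,
    Finset.sum_ite_eq' (Finset.range (M + 1)) lo, if_pos (Finset.mem_range.2 (Nat.lt_succ_of_le hhi)),
    if_pos (Finset.mem_range.2 (Nat.lt_succ_of_le hlo))]
  ring

/-- **law facts of the gated two-point cell** `Q = z·δ₀ + (1−z)·slice TP[lo,hi;γ] a g` (`lo ≤ hi ≤ M`, `0 ≤ γ ≤ 1`, `0 ≤ z ≤ 1`,
`0 ≤ g ≤ 1`): nonnegative, vanishing above `M + a`, mass `1`, mean `(1−z)(lo + (hi−lo)γ) + (1−z)·a·g`. [this work] -/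
theorem gateCell_laws (z g γ : ℝ) (a M lo hi : ℕ) (hz0 : 0 ≤ z) (hz1 : z ≤ 1) (hg0 : 0 ≤ g) (hg1 : g ≤ 1)
    (hγ0 : 0 ≤ γ) (hγ1 : γ ≤ 1) (hlo : lo ≤ M) (hhi : hi ≤ M) :
    (∀ h, 0 ≤ z * (if h = 0 then (1 : ℝ) else 0) + (1 - z) * slice (fun k => TP[lo, hi, γ, k]) a g h) ∧
    (∀ h, M + a < h → z * (if h = 0 then (1 : ℝ) else 0) + (1 - z) * slice (fun k => TP[lo, hi, γ, k]) a g h = 0) ∧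
    (∑ h ∈ Finset.range (M + a + 1), (z * (if h = 0 then (1 : ℝ) else 0) + (1 - z) * slice (fun k => TP[lo, hi, γ, k]) a g h) = 1) ∧
    (∑ h ∈ Finset.range (M + a + 1), (h : ℝ) * (z * (if h = 0 then (1 : ℝ) else 0) + (1 - z) * slice (fun k => TP[lo, hi, γ, k]) a g h)
      = (1 - z) * ((lo : ℝ) + ((hi : ℝ) - lo) * γ) + (1 - z) * ((a : ℝ) * g)) := by
  have hTP0 : ∀ k, 0 ≤ TP[lo, hi, γ, k] := fun k => by
    refine add_nonneg (mul_nonneg hγ0 ?_) (mul_nonneg (by linarith) ?_) <;> split_ifs <;> norm_num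
  have hTPM : ∀ k, M < k → TP[lo, hi, γ, k] = 0 := fun k hk => by
    rw [if_neg (by omega), if_neg (by omega)]; ring
  have hTP1 : ∑ k ∈ Finset.range (M + 1), TP[lo, hi, γ, k] = 1 := sum_TP_range M lo hi γ hlo hhi
  refine ⟨fun h => ?_, fun h hh => ?_, ?_, ?_⟩
  · refine add_nonneg (mul_nonneg hz0 (by split_ifs <;> norm_num)) (mul_nonneg (by linarith) ?_)
    exact slice_nonneg _ a g hg0 hg1 hTP0 h
  · rw [if_neg (by omega), mul_zero, zero_add, slice_eq_zero _ a g M hTPM h hh, mul_zero]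
  · rw [Finset.sum_add_distrib, ← Finset.mul_sum, ← Finset.mul_sum, sum_slice _ a g M hTPM hTP1,
      Finset.sum_ite_eq' (Finset.range (M + a + 1)) 0 (fun _ => (1 : ℝ)), if_pos (Finset.mem_range.2 (by omega))]
    ring
  · have e : ∀ h : ℕ, (h : ℝ) * (z * (if h = 0 then (1 : ℝ) else 0) + (1 - z) * slice (fun k => TP[lo, hi, γ, k]) a g h)
        = z * ((h : ℝ) * (if h = 0 then (1 : ℝ) else 0)) + (1 - z) * ((h : ℝ) * slice (fun k => TP[lo, hi, γ, k]) a g h) :=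
      fun h => by ring
    simp_rw [e]
    rw [Finset.sum_add_distrib, ← Finset.mul_sum, ← Finset.mul_sum, sum_mul_slice _ a g M hTPM hTP1,
      sum_mul_TP_range M lo hi γ hlo hhi]
    have hz : ∑ h ∈ Finset.range (M + a + 1), (h : ℝ) * (if h = 0 then (1 : ℝ) else 0) = 0 :=
      Finset.sum_eq_zero fun h _ => by split_ifs with h0 <;> simp [h0]
    rw [hz]; ring

/-- **THE ZERO-ONLY CELLS ARE DEC.**  `0 < y < 1`, `0 ≤ z < 1`, `y ≤ (1−z)g`, `g ≤ 1`, `1 ≤ a`, `lo ≤ hi ≤ M`, `0 ≤ γ ≤ 1`,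
top-affordability `y·M ≤ (1−z)(lo + (hi−lo)γ)`; `t := (1−z)(lo + (hi−lo)γ) + ag − zag` (the cell's mean).  If the cell
`Q = z·δ₀ + (1−z)·slice TP[lo,hi;γ] a g` has NO nonzero `t`-low (`Q l = 0` for `1 ≤ l ≤ j`, `2l < t`), then `Q` is `DECAtT y t j (M + a)`:
the zero rides every atom above `t` at the moment rates (`flowAtT_of_moment`; `y(M+a) ≤ t`). [this work] -/
theorem gateCell_decAtT_of_noLow (y z g γ : ℝ) (a j M lo hi : ℕ)
    (hy0 : 0 < y) (hy1 : y < 1) (hz0 : 0 ≤ z) (hz1 : z < 1) (hg1 : g ≤ 1) (hyg : y ≤ (1 - z) * g) (ha : 1 ≤ a)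
    (hlohi : lo ≤ hi) (hhi : hi ≤ M) (hγ0 : 0 ≤ γ) (hγ1 : γ ≤ 1)
    (hta : y * (M : ℝ) ≤ (1 - z) * ((lo : ℝ) + ((hi : ℝ) - lo) * γ))
    (hnz : ∀ l, 1 ≤ l → l ≤ j → 2 * (l : ℝ) < (1 - z) * ((lo : ℝ) + ((hi : ℝ) - lo) * γ) + (a : ℝ) * g - z * (a : ℝ) * g →
      z * (if l = 0 then (1 : ℝ) else 0) + (1 - z) * slice (fun k => TP[lo, hi, γ, k]) a g l = 0) :
    DECAtT y ((1 - z) * ((lo : ℝ) + ((hi : ℝ) - lo) * γ) + (a : ℝ) * g - z * (a : ℝ) * g) j (M + a)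
      (fun h => z * (if h = 0 then (1 : ℝ) else 0) + (1 - z) * slice (fun k => TP[lo, hi, γ, k]) a g h) := by
  have hg0 : 0 < g := by
    by_contra hc
    have : (1 - z) * g ≤ 0 := mul_nonpos_of_nonneg_of_nonpos (by linarith) (not_lt.1 hc)
    linarith
  obtain ⟨q0, qM, q1, qmean⟩ := gateCell_laws z g γ a M lo hi hz0 hz1.le hg0.le hg1 hγ0 hγ1 (hlohi.trans hhi) hhi
  set t : ℝ := (1 - z) * ((lo : ℝ) + ((hi : ℝ) - lo) * γ) + (a : ℝ) * g - z * (a : ℝ) * g with ht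
  have hta' : y * ((M + a : ℕ) : ℝ) ≤ t := by
    have h1 : y * (a : ℝ) ≤ (1 - z) * g * (a : ℝ) := mul_le_mul_of_nonneg_right hyg (Nat.cast_nonneg a)
    push_cast
    rw [mul_add, ht]
    nlinarith
  have htpos : 0 < t := by
    have h1 : 0 < (1 - z) * g * (a : ℝ) :=
      mul_pos (mul_pos (by linarith) hg0) (by exact_mod_cast (Nat.lt_of_lt_of_le Nat.zero_lt_one ha))
    have h2 : 0 ≤ (1 - z) * ((lo : ℝ) + ((hi : ℝ) - lo) * γ) := by
      refine mul_nonneg (by linarith) ?_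
      have : (lo : ℝ) ≤ hi := by exact_mod_cast hlohi
      nlinarith [(Nat.cast_nonneg lo : (0:ℝ) ≤ (lo:ℝ))]
    rw [ht]; nlinarith
  refine decAtT_of_flowAtT y t j (M + a) _ hy0 hy1 qM q1 ?_
  refine flowAtT_of_moment y t j (M + a) _ hy0 hy1 htpos q0 (fun l hl1 hlj hlow => hnz l hl1 hlj hlow) hta' ?_
  rw [q1, qmean, mul_one, ht]
  apply le_of_eq; ring

/-- **THE ZERO-ONLY CELLS, by atom positions**: in the regime `t ≤ 2a`, if every NONZERO atom `k ∈ {lo, hi}` charged by `TP[lo, hi; γ]`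
satisfies `t ≤ 2k`, the cell has no nonzero `t`-low and is DEC (`gateCell_decAtT_of_noLow`).  Covers: `a ≤ lo`; `t ≤ 2·lo`; `lo = 0 ∧ t ≤ 2·hi`;
`γ = 0 ∧ (lo = 0 ∨ t ≤ 2·lo)`; `γ = 1 ∧ (hi = 0 ∨ t ≤ 2·hi)`. [this work] -/
theorem gateCell_decAtT_of_le (y z g γ : ℝ) (a j M lo hi : ℕ)
    (hy0 : 0 < y) (hy1 : y < 1) (hz0 : 0 ≤ z) (hz1 : z < 1) (hg1 : g ≤ 1) (hyg : y ≤ (1 - z) * g) (ha : 1 ≤ a)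
    (hlohi : lo ≤ hi) (hhi : hi ≤ M) (hγ0 : 0 ≤ γ) (hγ1 : γ ≤ 1)
    (hta : y * (M : ℝ) ≤ (1 - z) * ((lo : ℝ) + ((hi : ℝ) - lo) * γ))
    (hreg : (1 - z) * ((lo : ℝ) + ((hi : ℝ) - lo) * γ) + (a : ℝ) * g - z * (a : ℝ) * g ≤ 2 * (a : ℝ))
    (hlo : lo = 0 ∨ γ = 1 ∨ (1 - z) * ((lo : ℝ) + ((hi : ℝ) - lo) * γ) + (a : ℝ) * g - z * (a : ℝ) * g ≤ 2 * (lo : ℝ))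
    (hhi' : hi = 0 ∨ γ = 0 ∨ (1 - z) * ((lo : ℝ) + ((hi : ℝ) - lo) * γ) + (a : ℝ) * g - z * (a : ℝ) * g ≤ 2 * (hi : ℝ)) :
    DECAtT y ((1 - z) * ((lo : ℝ) + ((hi : ℝ) - lo) * γ) + (a : ℝ) * g - z * (a : ℝ) * g) j (M + a)
      (fun h => z * (if h = 0 then (1 : ℝ) else 0) + (1 - z) * slice (fun k => TP[lo, hi, γ, k]) a g h) := by
  refine gateCell_decAtT_of_noLow y z g γ a j M lo hi hy0 hy1 hz0 hz1 hg1 hyg ha hlohi hhi hγ0 hγ1 hta ?_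
  intro l hl1 _ hlow
  have hl0 : l ≠ 0 := by omega
  rw [if_neg hl0, mul_zero, zero_add]
  simp only [slice]
  -- the unshifted part vanishes at `l`
  have hTPl : TP[lo, hi, γ, l] = 0 := by
    have ehi : γ * (if l = hi then (1 : ℝ) else 0) = 0 := by
      by_cases e : l = hi
      · subst e
        rcases hhi' with h0 | h0 | h0
        · exact absurd h0 hl0
        · rw [h0, zero_mul]
        · exfalso; linarith
      · rw [if_neg e, mul_zero]
    have elo : (1 - γ) * (if l = lo then (1 : ℝ) else 0) = 0 := by
      by_cases e : l = lo
      · subst e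
        rcases hlo with h0 | h0 | h0
        · exact absurd h0 hl0
        · rw [h0, sub_self, zero_mul]
        · exfalso; linarith
      · rw [if_neg e, mul_zero]
    rw [ehi, elo, add_zero]
  -- the shifted part vanishes at `l` (`l < t/2 ≤ a`)
  have hshift : (if a ≤ l then TP[lo, hi, γ, l - a] else 0) = 0 := by
    have hla : ¬ a ≤ l := by
      intro hal
      have : (a : ℝ) ≤ l := by exact_mod_cast hal
      linarith
    rw [if_neg hla]
  rw [hTPl, hshift, mul_zero, mul_zero, add_zero, mul_zero]

end LawDec

end Quant

end Summit.CriticalPhenomena.PercolationContinuityZ3.Theorems
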